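import Summits.BirchSwinnertonDyer.Rank1Residual.X12.CMRamifiedRecordSchemaH
import HarnessLib

/-!
# Leaf `CornerF ∧ CMRamified`, slice `p = 3`: PART H addendum «H-Sat» — the kernel certificate
# «the recorded generator of a regime-T member is NOT in `3·E(ℚ) + E(ℚ)[3]`» (no root of the
# `3`-division equation modulo a small prime), which makes PART H's levels `ñ, ñ'` generator-independent

HONEST FRAMING (cell `bsd-print-cfram`, run/shared/lean/pub/bsd-print-cfram/, verbatim in every file
of the cell): PARTITION currency only — the leaf counts when its class theorem is in the kernel BY
NAME, flag-free; Literature named facts are statement-only with cite tags, never sorried theorems;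
every imported theorem carries its printed hypotheses verbatim; numbers, not adjectives. THIS FILE IS
DATA INFRASTRUCTURE (computable functions, a certificate predicate, a record type, a display check,
unpacking lemmas, elementary bridge lemmas); nothing about any particular elliptic curve over `ℚ` is
asserted, no named fact is introduced, nothing is booked, no mark moves (regime child T =
`PrintCFram.LocalThreeTorsionBSDThree` = stmt-BirchSwinnertonDyer-20699 stays OPEN).

WHY. PART H (`X12/CMRamifiedRecordSchemaH.lean`, displays `X12/CMRamifiedTDefectThree{Cube,Split}*.lean`)
records for both members `W = E_k`, `W' = E_{k'}` of each of the 474 regime-T classes the level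
`ntilde` = `3`-divisibility level of CREMONA's generator `G` in `E(ℚ₃)` MODULO TORSION (two engines). The T
carrier of the route, `X12.O11.RamifiedCMEllipticUnitIndexAtThreeT` (ty2, `…RegimeTInputs.lean`, §1), binds
that level for a GENERATOR `P` of `E(ℚ)` modulo torsion (`hgen`, `hdiv`, `hndiv`). The two agree iff
`3 ∤ [E(ℚ) : ℤG + E(ℚ)_tors]`: with `E(ℚ)/tors ≅ ℤ·P` (rank one — `r_an = 1` + GZK, the route's named facts)
and `G ≡ mP`, the level of `loc G` in `E(ℚ₃)/tors ≅ ℤ₃` is `ñ(P) + v₃(m)`. So what PART H's `ñ` column needs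
from `G` is exactly **`G ∉ 3·E(ℚ) + E(ℚ)_tors`** — engine content so far (Cremona's `allgens` are saturated;
PART H's engines j287122/j287127 computed levels, not saturation). This file's certificate puts it in the
kernel, member by member (displays `X12/CMRamifiedTDefectThreeSat{CubeA,CubeB,CubeC,SplitA,SplitB,SplitC,SplitD}.lean`,
mirroring PART H's seven displays class by class; meaning PROVED in `X12/CMRamifiedRecordSchemaHSatMeaning.lean`).

THE CERTIFICATE `nonDivThreeCertX k A B p` — «no `Q ∈ E_k(ℚ)` has `x(3Q) = A/B`» (all checks in the
kernel): `p` prime (trial division), `p ∤ B`, and NO residue `x̄ mod p` satisfies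
`B·φ₃(x̄) ≡ A·ψ₃(x̄)² (mod p)`, where for `y² = x³ + k` Mathlib's division polynomials are
`φ₃ = x⁹ − 96k x⁶ + 48k² x³ + 64k³` (`PrintCFram.NoZetaNine.mordellCurve_φ_three_evalEval`, p3) and
`ψ₃² = 9x²(x³ + 4k)²` (`JZeroThree.mordellCurve_Ψ₃_eval`). MEANING (module level here; the bridge to
Mathlib's group law is elementary and is the subject of the sequel `…SchemaHSatMeaning.lean`): if `3Q = P`
with `x(P) = A/B` then `Q = (a/c, ·)` in lowest terms and `x(3Q) = φ₃(a/c)/ψ₃(a/c)²`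
[cite: SilvermanAEC2009, Exercise 3.7 (d)] (tree: `zsmul_some_eq_some_φ_div`), i.e.
`A·c·Ψ(a,c) = B·Φ(a,c)` in `ℤ` with the forms `Φ(a,c) = a⁹ − 96k a⁶c³ + 48k²a³c⁶ + 64k³c⁹`,
`Ψ(a,c) = 9a²(a³ + 4kc³)²`; if `p ∣ c` this reads `B·a⁹ ≡ 0`, so `p ∣ a` — impossible; hence `c` is a unit
mod `p` and `x̄ = a·c⁻¹` is a root. NO HYPOTHESIS on `p` beyond `p ∤ B` (good reduction is not used; the
test is blind to the group structure of `Ẽ(𝔽_p)`, so it also serves the members whose generator lies in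
the image of the rational `3`-isogeny from the partner curve, where every «`(#Ẽ(𝔽_p)/3)·Ḡ ≠ O`»-type test
of `…SchemaGSat.lean` fails at all primes).

TORSION. `E_k(ℚ)` (`k ≠ 0`) has a point of order `3` iff `k ∈ ℚ²` (the points `(0, ±√k)`) or
(`−3k ∈ ℚ²` and `−4k ∈ ℚ³`) (`JZeroThree.exists_three_torsion_mordellCurve_iff`); on the T population the
second kind does not occur (it is `27a`, rank `0`) and is EXCLUDED per member by a certificate. So a member
check `memberOK k X Y d p₀ s p₊ p₋ q₁ q₂ q₃` is: `k ≠ 0`, `d ≥ 1`, `G = (X/d², Y/d³)` on the curve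
(`Y² = X³ + k d⁶`), `nonDivThreeCertX k X d² p₀` (`G ∉ 3E(ℚ)`), and EITHER `s = 0` with `k` a quadratic
non-residue mod `q₁` (`⇒ k ∉ ℚ²`, PART F `not_isSquare_rat_of_nonResidue`) and (`−3k` a non-residue mod
`q₂` or `−4k` a cubic non-residue mod `q₃`, `⇒ −4k ∉ ℚ³`, `not_exists_rat_cube_of_cubeNonResidue`) — so
`E_k(ℚ)[3] = 0` —, OR `s > 0`, `s² = k`, `X ≠ 0`, and two more certificates for the translates
`G + T`, `G − T` by `T = (0, s)`: `x(G ± T) = 2sd(sd³ ∓ Y)/X²` (chord through `G` and `(0, ±s)`,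
[cite: SilvermanAEC2009, III.2.3]; here `E_k(ℚ)[3] = {O, ±T}` since `k > 0 ⇒ −3k ∉ ℚ²`). Either way:
**`G + t ∉ 3·E_k(ℚ)` for every `t ∈ E_k(ℚ)[3]`**. With `E_k(ℚ)[9] = E_k(ℚ)[3]` (no rational point of order
`9` on `y² = x³ + k` [cite: SilvermanAEC2009, Exercise 10.19]; = p3's `NoZetaNine.three_smul_eq_zero_of_nine_smul_eq_zero`
over `ℚ(√−3) ⊃ ℚ`) the proved group lemma `translate_ne_of_three_torsion_translates_ne` below absorbs ALL
torsion: `G ∉ 3·E_k(ℚ) + E_k(ℚ)_tors`.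

RECORD `HSatRow` = class key + per member (`label, k, G = (X, Y, d), p₀, s, p₊, p₋, q₁, q₂, q₃`); `ok` =
`memberOK` on both members; `matchesT` states the join with PART H's `TRow` (same class key, labels, `k`, `k'`
— the coordinates are NEW data: Cremona `allgens` moved to the Mordell model, HOME/ty3/partHSat/). Display
check `hsatCheck rows (n, nSq, nCube)`: all rows `ok`, `n` rows, `nSq` members in the square branch
(rational `3`-torsion), `nCube` members certified by the cubic non-residue (`−3k ∈ ℚ²`). Engines (kit
j290637 A = python replica of every function here ‖ j290733 B = PARI: `ellchangepoint`, `elltors`, exact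
`ellisdivisible(G + t, 3) = 0` for every rational `3`-torsion `t`, `ellsaturation` index `1`, and every certificate
prime / non-residue modulus recomputed independently): 948 members × 13 fields, 0 mismatches (HOME/ty3/partHSat/).
-/

set_option autoImplicit false

namespace Summit.BirchSwinnertonDyer.Rank1Residual.X12.CMRamifiedRecords

open Summit.BirchSwinnertonDyer.BirchSwinnertonDyer.Rank1Residual.HeegnerIndexRecords (isPrimeTD)

/-! ### §1 The `3`-division certificate on `y² = x³ + k` -/

/-- Mathlib's `φ₃` on `y² = x³ + k` as a polynomial in `x`: `x⁹ − 96k x⁶ + 48k² x³ + 64k³`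
(`PrintCFram.NoZetaNine.mordellCurve_φ_three_evalEval`). [cite: SilvermanAEC2009, Exercise 3.7 (d)] -/
def phi3M (k x : ℤ) : ℤ := x ^ 9 - 96 * k * x ^ 6 + 48 * k ^ 2 * x ^ 3 + 64 * k ^ 3

/-- `ψ₃² = 9x²(x³ + 4k)²` on `y² = x³ + k` (`JZeroThree.mordellCurve_Ψ₃_eval`: `Ψ₃ = 3x(x³ + 4k)`).
[cite: SilvermanAEC2009, Exercise 3.7] -/
def psi3SqM (k x : ℤ) : ℤ := 9 * x ^ 2 * (x ^ 3 + 4 * k) ^ 2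

/-- No residue `x̄ mod p` with `B·φ₃(x̄) ≡ A·ψ₃(x̄)²` (all `p` residues tried). [folklore] -/
def divThreeRootless (k A B : ℤ) (p : ℕ) : Bool :=
  (List.range p).all fun x => (B * phi3M k (x : ℤ) - A * psi3SqM k (x : ℤ)) % (p : ℤ) != 0

/-- **Certificate «no `Q ∈ E_k(ℚ)` with `x(3Q) = A/B`»** (module docstring): `p` prime, `p ∤ B`, and the
`3`-division equation for the abscissa `A/B` has no root mod `p`. [cite: SilvermanAEC2009, Exercise 3.7 (d)] -/
def nonDivThreeCertX (k A B : ℤ) (p : ℕ) : Bool :=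
  isPrimeTD p && (B % (p : ℤ) != 0) && divThreeRootless k A B p

/-- Unpacking the certificate. [folklore] -/
theorem nonDivThreeCertX_iff (k A B : ℤ) (p : ℕ) :
    nonDivThreeCertX k A B p = true ↔
      isPrimeTD p = true ∧ B % (p : ℤ) ≠ 0 ∧
        ∀ x : ℕ, x < p → (B * phi3M k (x : ℤ) - A * psi3SqM k (x : ℤ)) % (p : ℤ) ≠ 0 := by
  simp only [nonDivThreeCertX, divThreeRootless, Bool.and_eq_true, bne_iff_ne, ne_eq,
    List.all_eq_true, List.mem_range]
  tauto

/-! ### §2 The cubic non-residue certificate (`z` is not a rational cube) -/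

/-- `z` is a cubic NON-residue modulo `q ≥ 2`: no `x < q` has `x³ ≡ z (mod q)` (so `q ≡ 1 (mod 3)` in
every use). [folklore] -/
def cubeNonResidue (q : ℕ) (z : ℤ) : Bool :=
  decide (2 ≤ q) && (List.range q).all fun x => ((x : ℤ) ^ 3 - z) % (q : ℤ) != 0

/-- A cubic non-residue modulo some `q` is not the cube of an integer (PART F's
`not_isSquare_int_of_nonResidue`, cubed). [folklore] -/
theorem not_exists_int_cube_of_cubeNonResidue {q : ℕ} {z : ℤ} (h : cubeNonResidue q z = true) :
    ¬ ∃ m : ℤ, m ^ 3 = z := by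
  simp only [cubeNonResidue, Bool.and_eq_true, decide_eq_true_eq, List.all_eq_true, bne_iff_ne,
    ne_eq] at h
  obtain ⟨hq, hall⟩ := h
  rintro ⟨m, rfl⟩
  have hq0 : (0 : ℤ) < (q : ℤ) := by exact_mod_cast (show 0 < q by omega)
  have hx0 : 0 ≤ m % (q : ℤ) := Int.emod_nonneg _ (ne_of_gt hq0)
  have hxq : m % (q : ℤ) < (q : ℤ) := Int.emod_lt_of_pos _ hq0
  have hmem : (m % (q : ℤ)).toNat ∈ List.range q := by
    rw [List.mem_range]
    omega
  apply hall _ hmem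
  rw [Int.toNat_of_nonneg hx0]
  have h1 : (m % (q : ℤ)) ^ 3 ≡ m ^ 3 [ZMOD (q : ℤ)] := (Int.mod_modEq m (q : ℤ)).pow 3
  exact Int.emod_eq_zero_of_dvd h1.symm.dvd

/-- … hence not the cube of a rational: a rational `x` with `x³ ∈ ℤ` is an integer (`(x³).den = x.den³`).
[folklore] -/
theorem not_exists_rat_cube_of_cubeNonResidue {q : ℕ} {z : ℤ} (h : cubeNonResidue q z = true) :
    ¬ ∃ x : ℚ, x ^ 3 = (z : ℚ) := by
  rintro ⟨x, hx⟩
  have hden : x.den ^ 3 = 1 := by rw [← Rat.den_pow, hx, Rat.den_intCast]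
  have hx1 : x.den = 1 := by
    rcases Nat.pow_eq_one.mp hden with h1 | h3
    · exact h1
    · exact absurd h3 (by norm_num)
  have hxz : (x.num : ℚ) = x := Rat.coe_int_num_of_den_eq_one hx1
  refine not_exists_int_cube_of_cubeNonResidue h ⟨x.num, ?_⟩
  have h3 : ((x.num ^ 3 : ℤ) : ℚ) = ((z : ℤ) : ℚ) := by rw [Int.cast_pow, hxz, hx]
  exact_mod_cast h3

/-! ### §3 Absorbing the torsion (pure group theory, proved) -/

/-- In an additive commutative group whose `3`-power torsion is killed by `3` (`9t = 0 ⇒ 3t = 0`):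
`3^a · y = 0 ⇒ 3y = 0`. [folklore] -/
theorem three_smul_eq_zero_of_pow_smul_eq_zero {A : Type*} [AddCommGroup A]
    (h9 : ∀ t : A, 9 • t = 0 → 3 • t = 0) : ∀ (a : ℕ) (y : A), 3 ^ a • y = 0 → 3 • y = 0 := by
  intro a
  induction a with
  | zero => intro y hy; rw [pow_zero, one_smul] at hy; rw [hy, smul_zero]
  | succ a ih =>
    intro y hy
    rcases a with _ | a
    · simpa using hy
    · -- `3^(a+2) y = 9 · (3^a y) = 0 ⇒ 3 · (3^a y) = 3^(a+1) y = 0 ⇒` induction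
      have e : 3 ^ (a + 1 + 1) = 9 * 3 ^ a := by ring
      rw [e, mul_smul] at hy
      have h3 := h9 _ hy
      apply ih
      rw [pow_succ, mul_comm, mul_smul]
      exact h3

/-- **Torsion absorption.** If `G ≠ 3Q + t` for every `Q` and every `t` with `3t = 0`, and the group's
`3`-power torsion is killed by `3`, then `G ≠ 3Q + t` for every `Q` and every TORSION `t` (split `t` into its
`3`-part, killed by `3`, and its prime-to-`3` part, which is `3`-divisible by Bézout). [folklore] -/
theorem translate_ne_of_three_torsion_translates_ne {A : Type*} [AddCommGroup A] {G : A}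
    (h3 : ∀ t : A, 3 • t = 0 → ∀ Q : A, 3 • Q + t ≠ G)
    (h9 : ∀ t : A, 9 • t = 0 → 3 • t = 0) {t : A} (ht : IsOfFinAddOrder t) (Q : A) :
    3 • Q + t ≠ G := by
  obtain ⟨m, hm, hmt⟩ := ht.exists_nsmul_eq_zero
  have hmtz : (m : ℤ) • t = 0 := by rw [natCast_zsmul]; exact hmt
  -- `m = 3^a · m'` with `3 ∤ m'`
  obtain ⟨a, m', hm', hmeq⟩ := Nat.exists_eq_pow_mul_and_not_dvd hm.ne' 3 (by norm_num)
  have hcop : Nat.Coprime (3 ^ a) m' := (Nat.Coprime.pow_left a ((Nat.Prime.coprime_iff_not_dvd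
    (by norm_num : Nat.Prime 3)).mpr hm'))
  -- Bézout: `3^a·u + m'·v = 1`
  have hbez := Int.gcd_eq_gcd_ab (3 ^ a : ℕ) m'
  rw [show ((3 ^ a : ℕ) : ℤ).gcd (m' : ℤ) = 1 from by exact_mod_cast hcop] at hbez
  set u := ((3 ^ a : ℕ) : ℤ).gcdA m' with hu
  set v := ((3 ^ a : ℕ) : ℤ).gcdB m' with hv
  -- the two parts of `t`
  set t₃ := ((m' : ℤ) * v) • t with ht₃
  set t' := (((3 ^ a : ℕ) : ℤ) * u) • t with ht'
  have hsplit : t = t' + t₃ := by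
    rw [ht', ht₃, ← add_smul, show ((3 ^ a : ℕ) : ℤ) * u + (m' : ℤ) * v = 1 by
      push_cast at hbez ⊢; linarith [hbez], one_smul]
  -- `3 · t₃ = 0`
  have h3t₃ : 3 • t₃ = 0 := by
    apply three_smul_eq_zero_of_pow_smul_eq_zero h9 a
    rw [← natCast_zsmul, ht₃, smul_smul, show (((3 ^ a : ℕ) : ℤ)) * ((m' : ℤ) * v) = v * (m : ℤ) by
      rw [hmeq]; push_cast; ring, ← smul_smul, hmtz, smul_zero]
  -- `t'` is `3`-divisible: `m' · t' = 0` with `3 ∤ m'`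
  have hm't' : (m' : ℤ) • t' = 0 := by
    rw [ht', smul_smul, show (m' : ℤ) * (((3 ^ a : ℕ) : ℤ) * u) = u * (m : ℤ) by
      rw [hmeq]; push_cast; ring, ← smul_smul, hmtz, smul_zero]
  have hcop3 : Nat.Coprime 3 m' := (Nat.Prime.coprime_iff_not_dvd (by norm_num : Nat.Prime 3)).mpr hm'
  have hbez3 := Int.gcd_eq_gcd_ab (3 : ℕ) m'
  rw [show ((3 : ℕ) : ℤ).gcd (m' : ℤ) = 1 from by exact_mod_cast hcop3] at hbez3
  set r := ((3 : ℕ) : ℤ).gcdA m' with hr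
  set r' := ((3 : ℕ) : ℤ).gcdB m' with hr'
  have ht'div : t' = 3 • (r • t') := by
    calc t' = (((3 : ℕ) : ℤ) * r + (m' : ℤ) * r') • t' := by
          rw [show ((3 : ℕ) : ℤ) * r + (m' : ℤ) * r' = 1 by push_cast at hbez3 ⊢; linarith [hbez3],
            one_smul]
      _ = 3 • (r • t') := by
          rw [add_smul, mul_comm (m' : ℤ) r', ← smul_smul r', hm't', smul_zero, add_zero, ← smul_smul,
            natCast_zsmul]
  -- conclude
  intro hG
  apply h3 t₃ h3t₃ (Q + r • t')
  rw [smul_add, ← ht'div, add_assoc, ← hsplit]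
  exact hG

/-! ### §4 The member check -/

/-- **One member `E_k : y² = x³ + k` with recorded generator `G = (X/d², Y/d³)`** (module docstring,
§TORSION): `k ≠ 0`, `d ≥ 1`, `G` on the curve, `nonDivThreeCertX` for `x(G)` at `p₀`; then EITHER the
torsion-free branch `s = 0` (non-residue certificates: `k ∉ ℚ²` by `q₁`, and `−3k ∉ ℚ²` by `q₂` or
`−4k ∉ ℚ³` by `q₃`) OR the `ℤ/3` branch (`s² = k`, `s > 0`, `X ≠ 0`, certificates at `p₊`, `p₋` for the
abscissae `2sd(sd³ ∓ Y)/X²` of `G ± (0, s)`). [folklore] -/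
def memberOK (k X Y : ℤ) (d p₀ s pp pm q₁ q₂ q₃ : ℕ) : Bool :=
  (k != 0) && decide (1 ≤ d) && (Y ^ 2 == X ^ 3 + k * (d : ℤ) ^ 6) &&
  nonDivThreeCertX k X ((d : ℤ) ^ 2) p₀ &&
  (if s = 0 then
      nonResidue q₁ k && (nonResidue q₂ (-3 * k) || cubeNonResidue q₃ (-4 * k))
    else
      ((s : ℤ) ^ 2 == k) && (X != 0) &&
      nonDivThreeCertX k (2 * (s : ℤ) * (d : ℤ) * ((s : ℤ) * (d : ℤ) ^ 3 - Y)) (X ^ 2) pp &&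
      nonDivThreeCertX k (2 * (s : ℤ) * (d : ℤ) * ((s : ℤ) * (d : ℤ) ^ 3 + Y)) (X ^ 2) pm)

/-- The common part of a member check: `k ≠ 0`, `d ≥ 1`, `G` on the curve, the certificate for `x(G)`.
[folklore] -/
theorem memberOK_common {k X Y : ℤ} {d p₀ s pp pm q₁ q₂ q₃ : ℕ}
    (h : memberOK k X Y d p₀ s pp pm q₁ q₂ q₃ = true) :
    k ≠ 0 ∧ 1 ≤ d ∧ Y ^ 2 = X ^ 3 + k * (d : ℤ) ^ 6 ∧ nonDivThreeCertX k X ((d : ℤ) ^ 2) p₀ = true := by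
  unfold memberOK at h
  simp only [Bool.and_eq_true, bne_iff_ne, ne_eq, decide_eq_true_eq, beq_iff_eq] at h
  exact ⟨h.1.1.1.1, h.1.1.1.2, h.1.1.2, h.1.2⟩

/-- The torsion-free branch (`s = 0`): `k ∉ ℚ²`, and `−3k ∉ ℚ²` or `−4k ∉ ℚ³`. [folklore] -/
theorem memberOK_torsionFree {k X Y : ℤ} {d p₀ s pp pm q₁ q₂ q₃ : ℕ}
    (h : memberOK k X Y d p₀ s pp pm q₁ q₂ q₃ = true) (hs : s = 0) :
    ¬ IsSquare ((k : ℤ) : ℚ) ∧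
      (¬ IsSquare (((-3 * k : ℤ)) : ℚ) ∨ ¬ ∃ x : ℚ, x ^ 3 = ((-4 * k : ℤ) : ℚ)) := by
  unfold memberOK at h
  rw [if_pos hs] at h
  simp only [Bool.and_eq_true, Bool.or_eq_true] at h
  obtain ⟨-, h1, h2⟩ := h
  refine ⟨not_isSquare_rat_of_nonResidue h1, ?_⟩
  rcases h2 with h2 | h2
  · exact Or.inl (not_isSquare_rat_of_nonResidue h2)
  · exact Or.inr (not_exists_rat_cube_of_cubeNonResidue h2)

/-- The `ℤ/3` branch (`s ≠ 0`): `s² = k`, `X ≠ 0`, and the two translate certificates. [folklore] -/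
theorem memberOK_threeTorsion {k X Y : ℤ} {d p₀ s pp pm q₁ q₂ q₃ : ℕ}
    (h : memberOK k X Y d p₀ s pp pm q₁ q₂ q₃ = true) (hs : s ≠ 0) :
    (s : ℤ) ^ 2 = k ∧ X ≠ 0 ∧
      nonDivThreeCertX k (2 * (s : ℤ) * (d : ℤ) * ((s : ℤ) * (d : ℤ) ^ 3 - Y)) (X ^ 2) pp = true ∧
      nonDivThreeCertX k (2 * (s : ℤ) * (d : ℤ) * ((s : ℤ) * (d : ℤ) ^ 3 + Y)) (X ^ 2) pm = true := by
  unfold memberOK at h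
  rw [if_neg hs] at h
  simp only [Bool.and_eq_true, bne_iff_ne, ne_eq, beq_iff_eq] at h
  exact ⟨h.2.1.1.1, h.2.1.1.2, h.2.1.2, h.2.2⟩

/-! ### §5 The record and the display check -/

/-- One row per regime-T class of PART H: class key; member `W = E_k` — Cremona label, `k`, the recorded
generator `(X, Y, d)` (Cremona `allgens` moved to the Mordell model), its certificate prime `p₀`, the
square root `s` of `k` (`0` if `k ∉ ℚ²`), the translate primes `p₊, p₋` (`0` if unused), the non-residue
moduli `q₁, q₂, q₃` (`0` if unused); the same primed for `W' = E_{k'}`. [folklore] -/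
structure HSatRow where
  cls : String
  label : String
  k : ℤ
  gX : ℤ
  gY : ℤ
  gd : ℕ
  p0 : ℕ
  s : ℕ
  pp : ℕ
  pm : ℕ
  q1 : ℕ
  q2 : ℕ
  q3 : ℕ
  label' : String
  k' : ℤ
  gX' : ℤ
  gY' : ℤ
  gd' : ℕ
  p0' : ℕ
  s' : ℕ
  pp' : ℕ
  pm' : ℕ
  q1' : ℕ
  q2' : ℕ
  q3' : ℕ

namespace HSatRow

/-- Both members pass `memberOK`. [folklore] -/
def ok (r : HSatRow) : Bool :=
  memberOK r.k r.gX r.gY r.gd r.p0 r.s r.pp r.pm r.q1 r.q2 r.q3 &&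
    memberOK r.k' r.gX' r.gY' r.gd' r.p0' r.s' r.pp' r.pm' r.q1' r.q2' r.q3'

/-- The join with a PART H record: same class key, same labels, same `k`, `k'`. [folklore] -/
def matchesT (s : HSatRow) (r : TRow) : Bool :=
  (s.cls == r.cls) && (s.label == r.label) && (s.k == r.k) && (s.label' == r.label') && (s.k' == r.k')

/-- `ok` unpacked. [folklore] -/
theorem ok_iff (r : HSatRow) :
    r.ok = true ↔ memberOK r.k r.gX r.gY r.gd r.p0 r.s r.pp r.pm r.q1 r.q2 r.q3 = true ∧
      memberOK r.k' r.gX' r.gY' r.gd' r.p0' r.s' r.pp' r.pm' r.q1' r.q2' r.q3' = true := by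
  simp only [ok, Bool.and_eq_true]

/-- Number of members of this row in the `ℤ/3` branch (`s ≠ 0`) and in the cubic-non-residue branch
(`s = 0`, `q₂ = 0`). [folklore] -/
def tally (r : HSatRow) : ℕ × ℕ :=
  ((if r.s != 0 then 1 else 0) + (if r.s' != 0 then 1 else 0),
   (if r.s == 0 && r.q2 == 0 then 1 else 0) + (if r.s' == 0 && r.q2' == 0 then 1 else 0))

end HSatRow

/-- The display tally `(#rows, #members in the ℤ/3 branch, #members in the cubic-non-residue branch)`.
[folklore] -/
def hsatTally (rs : List HSatRow) : ℕ × ℕ × ℕ :=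
  (rs.length, (rs.map fun r => r.tally.1).sum, (rs.map fun r => r.tally.2).sum)

/-- Display check: every row `ok` and the tally as stated. [folklore] -/
def hsatCheck (rs : List HSatRow) (t : ℕ × ℕ × ℕ) : Bool :=
  rs.all HSatRow.ok && (hsatTally rs == t)

/-- Unpacking a display theorem per row. [folklore] -/
theorem HSatRow.ok_of_hsatCheck {rs : List HSatRow} {t : ℕ × ℕ × ℕ} (h : hsatCheck rs t = true)
    {r : HSatRow} (hr : r ∈ rs) : r.ok = true := by
  simp only [hsatCheck, Bool.and_eq_true] at h
  exact List.all_eq_true.1 h.1 r hr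

/-- The tally of a checked display. [folklore] -/
theorem hsatTally_eq_of_hsatCheck {rs : List HSatRow} {t : ℕ × ℕ × ℕ} (h : hsatCheck rs t = true) :
    hsatTally rs = t := by
  simp only [hsatCheck, Bool.and_eq_true, beq_iff_eq] at h
  exact h.2

end Summit.BirchSwinnertonDyer.Rank1Residual.X12.CMRamifiedRecords
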